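import Literature.Computability.MetaComplexity.GapMINKTDenseRandom
import Literature.Computability.Complexity.PairPlumbing
import Literature.Computability.Complexity.CookReducibilityTransitive
import Literature.Computability.Complexity.CoinCounting
import Literature.Computability.Complexity.UniformProbBlocks
import HarnessLib

/-!
# Hirahara's dense-subset lemma (proof): `Hirahara2018_dense_randomStrings_of_AvgDeltaP_holds`

Sibling proof file of `GapMINKTDenseRandom.lean` (D-0014: named facts `def X : Prop` are discharged
as `theorem X_holds : X`). It discharges

* `Literature.Computability.MetaComplexity.Hirahara2018_dense_randomStrings_of_AvgDeltaP_holds :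
  Hirahara2018_dense_randomStrings_of_AvgDeltaP` — **Hirahara 2018, Lemma 4.17** (ECCC TR18-138
  rev. 1; = Lemma IV.1 of the FOCS 2018 proceedings version, pp. 247–258): if `r(n) < n` for all
  large `n` and `(MINKT[r], 𝒟^KT) ∈ Avg_{1/6m}P`, then some `T ∈ P` has `T_t^{=n}` a `1/3`-dense
  subset of `R_t[r]` for all large `n` and every `t`.

## The printed proof and its rendering here

Printed proof (FOCS 2018, Lemma IV.1; ECCC rev. 1, Lemma 4.17 with Claim 4.18). Let `M` be the
errorless heuristic algorithm for `(MINKT[r], 𝒟^KT)`; put `T(x, 1^t) := [M(x, 1^t) = 0]` (the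
algorithm is run with the distributional parameter `m := |x| + t`, the unique `m` with
`(x, 1^t) ∈ supp 𝒟^KT_m`). "It is obvious that `T ∈ P`." Errorlessness gives `T_t ⊆ R_t[r]`.
Density: conditioned on `|x| = n`, `𝒟^KT_{n+t}` is uniform on `{0,1}^n × {1^t}` and the condition
has probability `1/m` (Claim 4.18), so `Pr_{x ∈ {0,1}^n}[M(x,1^t) = ⊥] ≤ m · 1/(6m) = 1/6`; the
number of `r`-nonrandom strings of length `n` is `< 2^{r(n)} ≤ 2^n / 2`, and `M` answers `1` only
on nonrandom strings (errorlessness), so `Pr_x[x ∈ T_t] ≥ 1 - 1/6 - 1/2 = 1/3`.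

Rendering (tree conventions of `DistProblems.lean` / `GapMINKTDenseRandom.lean`):

* the algorithm is `A : {0,1}* → ℕ → {0,1,⊥}`, polynomial-time on `⟨w, 1^m⟩ = paramEnc (w, m)`;
  the language is `T := {w | A w |concatFn w| = 0}` where `concatFn ⟨u, v⟩ = u ++ v`
  (`CookReducibilityTransitive.lean`), so that on a well-formed instance
  `w = (x, 1^t) = boolPair x 1^t` the parameter is `|x ++ 1^t| = |x| + t` (`length_concatFn_paramEnc`);
* `T ∈ P` (`setOf_test_mem_P`) is assembled from the `FP` toolkit: fan-out `w ↦ ⟨w, 1^{|concatFn w|}⟩`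
  (`fanoutFn`, `onesFn`), the unary-argument normal form of a `paramEnc`-machine
  (`mem_FP_of_unaryArg`), and `P`'s closure under `FP`-preimages of the equality test with the
  constant `optBoolEnc (some false)` (`setOf_apply_eq_apply_mem_P`, `preimage_mem_P`);
* Claim 4.18 is `uniformProb_paramEnc_le_mul_prob_DKT`:
  `Pr_{x ∈ {0,1}^n}[(x,1^t) ∈ S] ≤ (n+t) · Pr_{𝒟^KT_{n+t}}[S]`, read off the `bind`/`map` form of
  `DKT` (`PMF.toOuterMeasure_bind_apply`, the summand of index `n - 1`);
* the count of nonrandom strings is `card_lt_two_pow_of_ktAt_lt` (the finset form of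
  `UniversalMachine.ncard_setOf_ktAt_lt`: programs of length `< k` inject into
  `Σ j < k, {0,1}^j`, of size `2^k - 1`), giving `Pr_x[K^t(x) < k] ≤ 1/2` for `k < n`
  (`uniformProb_ktAt_lt_le_half`);
* errorlessness is used only at instances `(x, 1^t)` with `|x| ≥ 1`, which lie in
  `supp 𝒟^KT_{|x|+t}` (`paramEnc_mem_support_DKT`); accordingly the threshold is `max n₀ 1`.

## References

* S. Hirahara, *Non-black-box worst-case to average-case reductions within NP*, FOCS 2018,
  247–258, Lemma IV.1 (text checked: proceedings version, §IV "In a world of Heuristica");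
  full version ECCC TR18-138 rev. 1 (2019), Lemma 4.17 with Claim 4.18 [Hirahara2018].
* A. Bogdanov, L. Trevisan, *Average-case complexity*, FnT-TCS 2 (2006), Def. 2.7 (`Avg_δP`)
  [BogdanovTrevisan2006].
-/

namespace Literature.Computability.MetaComplexity

open _root_.Computability Complexity
open scoped ENNReal

/-! ### Counting: uniform probability on `{0,1}^n` -/

/-- Monotonicity of `Pr_{x ∈ {0,1}^n}` along an implication that holds on strings of length `n`.
[folklore] -/
private theorem uniformProb_mono_len {n : ℕ} {E F : Set (List Bool)}
    (h : ∀ x : List Bool, x.length = n → x ∈ E → x ∈ F) : uniformProb n E ≤ uniformProb n F := by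
  classical
  unfold uniformProb
  refine div_le_div_of_nonneg_right ?_ (by positivity)
  exact_mod_cast Finset.card_le_card fun r hr => by
    simp only [Finset.mem_filter, Finset.mem_univ, true_and] at hr ⊢
    exact h _ r.toList_length hr

/-- Fewer than `2^k` strings of a fixed length have `K^t`-complexity `< k`: a finite set of such
strings injects (choose a shortest program for each) into `Σ j < k, {0,1}^j`, of cardinality
`∑_{j<k} 2^j < 2^k` — the finset form of `UniversalMachine.ncard_setOf_ktAt_lt` ("the number of
`r`-nonrandom strings of length `n` is at most `∑_{i<r(n)} 2^i ≤ 2^{r(n)}`").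
[cite: Hirahara2018, Lemma 4.17 (proof)] -/
private theorem card_lt_two_pow_of_ktAt_lt (U : UniversalMachine) {t k n : ℕ}
    (F : Finset (List.Vector Bool n)) (hF : ∀ v ∈ F, U.ktAt t v.toList < k) : F.card < 2 ^ k := by
  have hS : ∀ v : F, ∃ prog, U.run prog t = some v.1.toList ∧ prog.length < k := fun v => by
    obtain ⟨prog, h1, h2⟩ := U.exists_run_eq_of_ktAt_lt (hF v.1 v.2)
    exact ⟨prog, h1, by exact_mod_cast h2⟩
  choose f hf hfl using hS
  let g : F → Σ j : Fin k, List.Vector Bool j := fun v => ⟨⟨(f v).length, hfl v⟩, ⟨f v, rfl⟩⟩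
  have hg : Function.Injective g := by
    intro v v' h
    have h' : f v = f v' :=
      congr_arg (fun s : Σ j : Fin k, List.Vector Bool j => s.2.toList) h
    have h2 : some v.1.toList = some v'.1.toList := (hf v).symm.trans (h' ▸ hf v')
    exact Subtype.ext (List.Vector.toList_injective (Option.some.inj h2))
  calc F.card = Fintype.card F := (Fintype.card_coe F).symm
    _ ≤ Fintype.card (Σ j : Fin k, List.Vector Bool j) := Fintype.card_le_of_injective g hg
    _ = ∑ j ∈ Finset.range k, 2 ^ j := by
      rw [Fintype.card_sigma]
      simp only [card_vector, Fintype.card_bool]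
      exact Fin.sum_univ_eq_sum_range (fun j => 2 ^ j) k
    _ < 2 ^ k := Nat.geomSum_lt le_rfl fun j hj => Finset.mem_range.mp hj

/-- For `k < n`, a uniformly random string of length `n` is `k`-nonrandom w.r.t. `K^t` with
probability at most `1/2`: fewer than `2^k ≤ 2^{n-1}` strings of length `n` have `K^t(x) < k`
("the probability that `(x, 1^t) ∈ MINKT[r]` over `x ∈_R {0,1}^n` is at most `2^{r(n)-n} ≤ 1/2`").
[cite: Hirahara2018, Lemma 4.17 (proof)] -/
private theorem uniformProb_ktAt_lt_le_half (U : UniversalMachine) (t : ℕ) {k n : ℕ} (hk : k < n) :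
    uniformProb n {x | U.ktAt t x < k} ≤ 1 / 2 := by
  have key : ∀ F : Finset (List.Vector Bool n), (∀ v ∈ F, U.ktAt t v.toList < k) →
      (F.card : ℝ) ≤ 1 / 2 * 2 ^ n := by
    intro F hF
    have h1 : F.card < 2 ^ (n - 1) :=
      lt_of_lt_of_le (card_lt_two_pow_of_ktAt_lt U F hF) (Nat.pow_le_pow_right (by norm_num) (by omega))
    have h2 : (F.card : ℝ) ≤ (2 : ℝ) ^ (n - 1) := by exact_mod_cast h1.le
    have h3 : (2 : ℝ) ^ n = 2 * 2 ^ (n - 1) := by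
      rw [← pow_succ']
      congr 1
      omega
    rw [h3]
    linarith
  unfold uniformProb
  rw [div_le_iff₀ (by positivity)]
  exact key _ fun v hv => by
    simp only [Finset.mem_filter, Finset.mem_univ, true_and] at hv
    exact hv

/-! ### Claim 4.18: conditioning `𝒟^KT_{n+t}` on `|x| = n` -/

/-- The summand of index `i` of the mixture `𝒟^KT_m` (`m ≥ 1`): for every event `S`,
`(1/m) · Pr_{x ∈ {0,1}^{i+1}}[(x, 1^{m-(i+1)}) ∈ S] ≤ Pr_{𝒟^KT_m}[S]`.
[cite: Hirahara2018, Claim 4.18] -/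
private theorem inv_mul_toOuterMeasure_le_DKT {m : ℕ} (hm : m ≠ 0) (i : Fin m) (S : Set (List Bool)) :
    (m : ℝ≥0∞)⁻¹ * (uniformEnsemble (i.1 + 1)).toOuterMeasure
        ((fun x => paramEnc (x, m - (i.1 + 1))) ⁻¹' S) ≤ (DKT m).toOuterMeasure S := by
  haveI : NeZero m := ⟨hm⟩
  unfold DKT
  rw [dif_neg hm, PMF.toOuterMeasure_bind_apply]
  refine le_trans (le_of_eq ?_) (ENNReal.le_tsum i)
  rw [PMF.uniformOfFintype_apply, Fintype.card_fin, PMF.toOuterMeasure_map_apply]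

/-- **Hirahara 2018, Claim 4.18** (in the form used): for `n ≥ 1` and every event `S`,
`Pr_{x ∈ {0,1}^n}[(x, 1^t) ∈ S] ≤ (n + t) · Pr_{𝒟^KT_{n+t}}[S]` — the distribution `𝒟^KT_{n+t}`
conditioned on `|x| = n` is uniform on `{(x, 1^t) | x ∈ {0,1}^n}` and the condition has
probability `1/(n+t)`. [cite: Hirahara2018, Claim 4.18] -/
private theorem uniformProb_paramEnc_le_mul_prob_DKT {n : ℕ} (hn : 1 ≤ n) (t : ℕ)
    (S : Set (List Bool)) :
    uniformProb n {x | paramEnc (x, t) ∈ S} ≤ ((n + t : ℕ) : ℝ) * DKT.prob (n + t) S := by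
  have hm0 : n + t ≠ 0 := by omega
  have key : ((n + t : ℕ) : ℝ≥0∞)⁻¹ * (uniformEnsemble n).toOuterMeasure {x | paramEnc (x, t) ∈ S} ≤
      (DKT (n + t)).toOuterMeasure S := by
    have h := inv_mul_toOuterMeasure_le_DKT hm0 ⟨n - 1, by omega⟩ S
    simp only [Nat.sub_add_cancel hn, Nat.add_sub_cancel_left] at h
    exact h
  have hY : (DKT (n + t)).toOuterMeasure S ≠ ⊤ := by
    rw [PMF.toOuterMeasure_apply]
    exact PMF.tsum_coe_indicator_ne_top _ _
  have hmtop : ((n + t : ℕ) : ℝ≥0∞) ≠ ⊤ := ENNReal.natCast_ne_top _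
  have key' : (uniformEnsemble n).toOuterMeasure {x | paramEnc (x, t) ∈ S} ≤
      ((n + t : ℕ) : ℝ≥0∞) * (DKT (n + t)).toOuterMeasure S := by
    calc (uniformEnsemble n).toOuterMeasure {x | paramEnc (x, t) ∈ S}
        = ((n + t : ℕ) : ℝ≥0∞) * (((n + t : ℕ) : ℝ≥0∞)⁻¹ *
            (uniformEnsemble n).toOuterMeasure {x | paramEnc (x, t) ∈ S}) := by
          rw [← mul_assoc, ENNReal.mul_inv_cancel (by exact_mod_cast hm0) hmtop, one_mul]
      _ ≤ ((n + t : ℕ) : ℝ≥0∞) * (DKT (n + t)).toOuterMeasure S := mul_le_mul_right key _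
  calc uniformProb n {x | paramEnc (x, t) ∈ S}
      = ((uniformEnsemble n).toOuterMeasure {x | paramEnc (x, t) ∈ S}).toReal := by
        rw [← prob_uniformEnsemble]
        rfl
    _ ≤ (((n + t : ℕ) : ℝ≥0∞) * (DKT (n + t)).toOuterMeasure S).toReal :=
        ENNReal.toReal_mono (ENNReal.mul_ne_top hmtop hY) key'
    _ = ((n + t : ℕ) : ℝ) * DKT.prob (n + t) S := by
        rw [ENNReal.toReal_mul, ENNReal.toReal_natCast]
        rfl

/-! ### The language `T` and errorlessness -/

/-- On a well-formed instance `(x, 1^t) = boolPair x 1^t` the parameter fed to the algorithm is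
`|concatFn (x, 1^t)| = |x ++ 1^t| = |x| + t`. [folklore] -/
private theorem length_concatFn_paramEnc (x : List Bool) (t : ℕ) :
    (OracleCompose.concatFn (paramEnc (x, t))).length = x.length + t := by
  change (OracleCompose.concatFn (boolPair x (unaryEncodeNat t))).length = _
  rw [OracleCompose.concatFn_boolPair, List.length_append]
  exact congrArg (x.length + ·) (unary_decode_encode_nat t)

/-- **`T ∈ P`** ("By this definition, it is obvious that `T ∈ P`"): for a polynomial-time
`A : ⟨w, 1^m⟩ ↦ {0, 1, ⊥}`, the language `{w | A(w, 1^{|concatFn w|}) = 0}` is in `P` — fan out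
`w ↦ ⟨w, 1^{|concatFn w|}⟩` (`fanoutFn`, `onesFn`, `concatFn`), run the machine of `A` in its
unary-argument normal form (`mem_FP_of_unaryArg`), and compare with the constant `optBoolEnc 0`
(`setOf_apply_eq_apply_mem_P`, `preimage_mem_P`). [cite: Hirahara2018, Lemma 4.17 (proof)] -/
private theorem setOf_test_mem_P {A : List Bool → ℕ → Option Bool}
    (hA : PolyTimeComputable paramEnc optBoolEnc (Function.uncurry A)) :
    ({w | A w (OracleCompose.concatFn w).length = some false} : Language Bool) ∈ Classes.P := by
  have hF : (fun v => optBoolEnc (A (boolUnpair v).1 (boolUnpair v).2.length)) ∈ FP :=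
    mem_FP_of_unaryArg hA
  have hP : fanoutFn id (onesFn ∘ OracleCompose.concatFn) ∈ FP :=
    fanoutFn_mem_FP OracleCompose.id_mem_FP
      (comp_mem_FP onesFn_mem_FP OracleCompose.concatFn_mem_FP)
  have hG := comp_mem_FP hF hP
  have hEq := setOf_apply_eq_apply_mem_P OracleCompose.id_mem_FP
    (const_mem_FP (optBoolEnc (some false)))
  convert preimage_mem_P hEq hG using 1
  ext w
  change A w (OracleCompose.concatFn w).length = some false ↔
    id (optBoolEnc (A (boolUnpair (fanoutFn id (onesFn ∘ OracleCompose.concatFn) w)).1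
      (boolUnpair (fanoutFn id (onesFn ∘ OracleCompose.concatFn) w)).2.length)) =
      optBoolEnc (some false)
  simp only [fanoutFn_apply, boolUnpair_boolPair, Function.comp_apply, id_eq, length_onesFn]
  exact (encodingBoolBool.optionBool).encode_injective.eq_iff.symm

/-- Errorlessness at a well-formed instance with `|x| ≥ 1` (which lies in `supp 𝒟^KT_{|x|+t}`):
if the algorithm answers `0` on `(x, 1^t)` with parameter `|x| + t`, then `(x, 1^t) ∉ MINKT[r]`,
i.e. `x` is `r`-random ("Since `M` is an errorless heuristic algorithm, we obtain
`K_t(x) ≥ r(|x|)`"). [cite: Hirahara2018, Lemma 4.17 (proof)] -/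
private theorem mem_randomStrings_of_eq_some_false {U : UniversalMachine} {r : ℕ → ℕ}
    {A : List Bool → ℕ → Option Bool} (herr : IsErrorlessFor A ⟨U.MINKTr r, DKT⟩)
    {x : List Bool} (hx : 1 ≤ x.length) {t : ℕ}
    (h : A (paramEnc (x, t)) (x.length + t) = some false) : x ∈ U.randomStrings t r := by
  have hsupp := paramEnc_mem_support_DKT (List.ne_nil_of_length_pos hx) t
  have hb := herr (x.length + t) (paramEnc (x, t)) hsupp false h
  have hnot : paramEnc (x, t) ∉ U.MINKTr r := (Set.notMem_iff_boolIndicator _ _).2 hb.symm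
  by_contra hxR
  exact hnot (U.paramEnc_mem_MINKTr_iff_not_mem_randomStrings.2 hxR)

/-- Errorlessness, the other answer: if the algorithm answers `1` on `(x, 1^t)` (`|x| ≥ 1`,
parameter `|x| + t`), then `(x, 1^t) ∈ MINKT[r]`, i.e. `K^t(x) < r(|x|)`.
[cite: Hirahara2018, Lemma 4.17 (proof)] -/
private theorem ktAt_lt_of_eq_some_true {U : UniversalMachine} {r : ℕ → ℕ}
    {A : List Bool → ℕ → Option Bool} (herr : IsErrorlessFor A ⟨U.MINKTr r, DKT⟩)
    {x : List Bool} (hx : 1 ≤ x.length) {t : ℕ}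
    (h : A (paramEnc (x, t)) (x.length + t) = some true) : U.ktAt t x < r x.length := by
  have hsupp := paramEnc_mem_support_DKT (List.ne_nil_of_length_pos hx) t
  have hb := herr (x.length + t) (paramEnc (x, t)) hsupp true h
  have hmem : paramEnc (x, t) ∈ U.MINKTr r := (Set.mem_iff_boolIndicator _ _).2 hb.symm
  exact U.paramEnc_mem_MINKTr_iff.1 hmem

/-! ### Lemma 4.17 -/

/-- **Discharge of `Hirahara2018_dense_randomStrings_of_AvgDeltaP` (Hirahara 2018, Lemma 4.17;
FOCS version Lemma IV.1).** Given the errorless heuristic algorithm `A` for `(MINKT[r], 𝒟^KT)` with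
failure probability `≤ 1/6m`, take `T := {w | A(w, 1^{|concatFn w|}) = 0}` — on a well-formed
instance `(x, 1^t)` this runs `A` with the parameter `m = |x| + t` of the unique `𝒟^KT_m` whose
support contains it. `T ∈ P` (`setOf_test_mem_P`); for `n ≥ max n₀ 1` and every `t`:
`T_t^{=n} ⊆ R_t[r]` by errorlessness (`mem_randomStrings_of_eq_some_false`), and
`Pr_{x ∈ {0,1}^n}[x ∈ T_t] ≥ 1 - Pr[A = ⊥] - Pr[A = 1] ≥ 1 - (n+t) · 1/(6(n+t)) - 1/2 = 1/3`
by Claim 4.18 (`uniformProb_paramEnc_le_mul_prob_DKT`), errorlessness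
(`ktAt_lt_of_eq_some_true`) and the count of nonrandom strings (`uniformProb_ktAt_lt_le_half`,
using `r(n) < n`). [cite: Hirahara2018, Lemma 4.17] -/
theorem Hirahara2018_dense_randomStrings_of_AvgDeltaP_holds :
    Hirahara2018_dense_randomStrings_of_AvgDeltaP := by
  rintro U r ⟨n₀, hr⟩ ⟨A, hA, herr, hfail⟩
  refine ⟨({w | A w (OracleCompose.concatFn w).length = some false} : Language Bool),
    setOf_test_mem_P hA, max n₀ 1, fun n hn t => ⟨?_, ?_⟩⟩
  · -- `T_t^{=n} ⊆ R_t[r]`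
    rintro x ⟨hxn, hxT⟩
    have hx1 : 1 ≤ x.length := by rw [hxn]; exact le_of_max_le_right hn
    have h : A (paramEnc (x, t)) (OracleCompose.concatFn (paramEnc (x, t))).length = some false :=
      hxT
    rw [length_concatFn_paramEnc] at h
    exact mem_randomStrings_of_eq_some_false herr hx1 h
  · -- density `≥ 1/3`
    have hn1 : 1 ≤ n := le_of_max_le_right hn
    have hrn : r n < n := hr n (le_of_max_le_left hn)
    -- failures: `≤ (n+t) · 1/(6(n+t)) = 1/6` (Claim 4.18)
    have hnone : uniformProb n {x | A (paramEnc (x, t)) (n + t) = none} ≤ 1 / 6 := by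
      have h1 := uniformProb_paramEnc_le_mul_prob_DKT hn1 t {w | A w (n + t) = none}
      have h2 : DKT.prob (n + t) {w | A w (n + t) = none} ≤ 1 / (6 * ((n + t : ℕ) : ℝ)) :=
        hfail (n + t)
      have hm0 : ((n + t : ℕ) : ℝ) ≠ 0 := by exact_mod_cast (show n + t ≠ 0 by omega)
      calc uniformProb n {x | A (paramEnc (x, t)) (n + t) = none}
          ≤ ((n + t : ℕ) : ℝ) * DKT.prob (n + t) {w | A w (n + t) = none} := h1
        _ ≤ ((n + t : ℕ) : ℝ) * (1 / (6 * ((n + t : ℕ) : ℝ))) :=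
          mul_le_mul_of_nonneg_left h2 (Nat.cast_nonneg _)
        _ = 1 / 6 := by
          rw [mul_one_div, mul_comm (6 : ℝ) ((n + t : ℕ) : ℝ), ← div_div, div_self hm0]
    -- answers `1`: only on `r`-nonrandom strings, `< 2^{r n} ≤ 2^n / 2` of them
    have htrue : uniformProb n {x | A (paramEnc (x, t)) (n + t) = some true} ≤ 1 / 2 := by
      refine le_trans (uniformProb_mono_len fun x hx h => ?_) (uniformProb_ktAt_lt_le_half U t hrn)
      have h' : A (paramEnc (x, t)) (x.length + t) = some true := by rw [hx]; exact h
      have hlt := ktAt_lt_of_eq_some_true herr (by omega) h'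
      rw [hx] at hlt
      exact hlt
    -- the remaining strings answer `0`
    have hunion := uniformProb_union_le n {x | A (paramEnc (x, t)) (n + t) = some true}
      {x | A (paramEnc (x, t)) (n + t) = none}
    refine le_trans ?_ (uniformProb_mono_len
      (E := ({x | A (paramEnc (x, t)) (n + t) = some true} ∪
        {x | A (paramEnc (x, t)) (n + t) = none})ᶜ) fun x hx h => ?_)
    · rw [uniformProb_compl]
      linarith
    · simp only [Set.mem_compl_iff, Set.mem_union, Set.mem_setOf_eq, not_or] at h
      change A (paramEnc (x, t)) (OracleCompose.concatFn (paramEnc (x, t))).length = some false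
      rw [length_concatFn_paramEnc, hx]
      cases hv : A (paramEnc (x, t)) (n + t) with
      | none => exact absurd hv h.2
      | some b =>
        cases b with
        | true => exact absurd hv h.1
        | false => rfl

end Literature.Computability.MetaComplexity
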